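import Summits.CriticalPhenomena.PercolationContinuityZ3.Theses.PercNonProliferation
import Summits.CriticalPhenomena.PercolationContinuityZ3.Theorems.NonProliferation.Negative.AboveSix
import Literature.Probability.Percolation.PlanarDuality
import HarnessLib

/-!
# Crux `PercNonProliferation.NonProliferation` (stmt-CriticalPhenomena-4444) follows from
# bounded-budget tightness AT RATIO 2 (the `l = 2` slice of `PercBudgetLadder.BudgetTightness`)

A cross-route remark recorded as a theorem (lead of line `birth-merge-ledger`). Write `N_n` for the
number of clusters of the open graph induced on `B(2n)` meeting both `B(n)` and `∂ⁱⁿB(2n)`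
(`{N_n ≥ M+1} = repEvent 3 M n`), and `MinCut_n` for the least number of edges whose closure destroys
every open crossing from `B(n)` to `∂ⁱⁿB(2n)` inside `B(2n)`. Pointwise (for configurations supported
on lattice edges, an almost sure event) `N_n ≤ MinCut_n`: each spanning cluster carries an open
crossing walk, a destroying set must contain an edge of each of these walks, and two distinct
clusters cannot share an edge (purely combinatorial: `BudgetBridge.notMem_repEvent_of_cut`). Hence the
`l = 2` slice of the crux `BudgetTightness` of route `PercBudgetLadder` (stmt-CriticalPhenomena-5248:
"with probability `≥ c`, for infinitely many `n`, at most `k` edges destroy all crossings of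
`B(n) → ∂ⁱⁿB(l n)`", there with `∃ l ≥ 2`) implies `NonProliferation` with `M = k` and the same `c`
(`nonProliferation_of_budgetTightness_two`). The general-`l` item does not transfer pointwise (a
ratio-2 spanning cluster need not reach `∂ⁱⁿB(l n)`), which is why only the `l = 2` slice is recorded.
-/

noncomputable section

namespace Summit.CriticalPhenomena.PercolationContinuityZ3.Theorems.NonProliferation

open MeasureTheory Filter Topology
open Literature.Probability.LatticeModels Literature.Probability.Percolation
open Summit.CriticalPhenomena.PercolationContinuityZ3.Theorems.NonProliferation.Negative

namespace BudgetBridge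

/-- If a `G`-walk inside `S` with `ω`-open edges avoids the edge set `T`, its endpoints are joined in
`ω \ T` inside `S`. -/
theorem mem_openConnIn_sdiff_of_walk {V : Type*} {G : SimpleGraph V} {ω : BondConfig V} {S : Set V}
    {T : Set (Sym2 V)} {x y : V} (p : G.Walk x y) (hS : ∀ z ∈ p.support, z ∈ S)
    (hω : ∀ e ∈ p.edges, e ∈ ω) (hT : ∀ e ∈ p.edges, e ∉ T) : ω \ T ∈ openConnIn S x y :=
  mem_openConnIn_of_walk p hS fun e he => ⟨hω e he, hT e he⟩

/-- **`N_n ≤ MinCut_n`, pointwise.** For a configuration on lattice edges: if closing the edges of a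
finite set `S` with `#S ≤ k` destroys every open crossing of `B(n) → ∂ⁱⁿB(2n)` inside `B(2n)`, then
there are no `k+1` pairwise-unjoined spanning representatives (`ω ∉ repEvent d k n`). -/
theorem notMem_repEvent_of_cut {d k n : ℕ} {ω : BondConfig (Site d)} (hω : ω ⊆ (zdGraph d).edgeSet)
    {S : Finset (Sym2 (Site d))} (hS : S.card ≤ k)
    (hcut : ¬ ∃ x ∈ box d n, ∃ y ∈ innerBoundary (zdGraph d) (box d (2 * n)),
      (ω \ ↑S) ∈ openConnIn (↑(box d (2 * n)) : Set (Site d)) x y) :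
    ω ∉ repEvent d k n := by
  classical
  rintro ⟨x, hx, hconn, hdisj⟩
  -- each representative has an open lattice walk inside the box to the boundary; it uses an edge of
  -- `S`, and the representative is joined inside the box to BOTH endpoints of that edge
  have key : ∀ i, ∃ e ∈ S, ∀ u ∈ e, ω ∈ openConnIn (↑(box d (2 * n)) : Set (Site d)) (x i) u := by
    intro i
    obtain ⟨y, hy, hxy⟩ := hconn i
    obtain ⟨p, hpS, hpω⟩ := exists_walk_of_mem_openConnIn hω hxy
    by_contra hne
    push Not at hne
    have havoid : ∀ e ∈ p.edges, e ∉ (↑S : Set (Sym2 (Site d))) := by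
      intro e he heS
      obtain ⟨u, hu, hnu⟩ := hne e heS
      exact hnu (mem_openConnIn_of_mem_support p hpS hpω
        (SimpleGraph.Walk.mem_support_of_mem_edges he hu))
    exact hcut ⟨x i, hx i, y, hy, mem_openConnIn_sdiff_of_walk p hpS hpω havoid⟩
  choose e heS hxu using key
  -- the edges are pairwise distinct: a shared edge joins two representatives inside the box
  have hinj : Function.Injective e := by
    intro i j hij
    by_contra hne
    obtain ⟨u, hu⟩ : ∃ u, u ∈ e i := ⟨(e i).out.1, Sym2.out_fst_mem (e i)⟩
    have hui : ω ∈ openConnIn (↑(box d (2 * n)) : Set (Site d)) (x i) u := hxu i u hu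
    have huj : ω ∈ openConnIn (↑(box d (2 * n)) : Set (Site d)) (x j) u := hxu j u (hij ▸ hu)
    rw [openConnIn_comm] at huj
    exact hdisj i j hne (PlanarDuality.openConnIn_trans hui huj)
  have hcard : k + 1 ≤ S.card := by
    calc k + 1 = (Finset.univ : Finset (Fin (k + 1))).card := by simp
      _ = (Finset.univ.image e).card := (Finset.card_image_of_injective _ hinj).symm
      _ ≤ S.card := Finset.card_le_card (by
          intro f hf
          obtain ⟨i, -, rfl⟩ := Finset.mem_image.1 hf
          exact heS i)
  omega

/-- Measure form: `P_p(∃ S, #S ≤ k ∧ ω ∖ S has no crossing) ≤ P_p((repEvent d k n)ᶜ)` (lattice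
configurations have full measure, `setBernoulli_ae_subset`). -/
theorem real_cut_le_real_compl_repEvent (d k n : ℕ) (p : unitInterval) :
    (bondPercolation (zdGraph d) p).real
        {ω | ∃ S : Finset (Sym2 (Site d)), S.card ≤ k ∧
          ¬ ∃ x ∈ box d n, ∃ y ∈ innerBoundary (zdGraph d) (box d (2 * n)),
            (ω \ ↑S) ∈ openConnIn (↑(box d (2 * n)) : Set (Site d)) x y} ≤
      (bondPercolation (zdGraph d) p).real (repEvent d k n)ᶜ := by
  refine ENNReal.toReal_mono (measure_ne_top _ _) (measure_mono_ae ?_)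
  have hsub : ∀ᵐ ω ∂(bondPercolation (zdGraph d) p), ω ⊆ (zdGraph d).edgeSet :=
    ProbabilityTheory.setBernoulli_ae_subset
  filter_upwards [hsub] with ω hω hcutev
  obtain ⟨S, hS, hcut⟩ := hcutev
  exact notMem_repEvent_of_cut hω hS hcut

end BudgetBridge

/-- **`BudgetTightness` at ratio `l = 2` implies `NonProliferation`.** If for some `k` and `c > 0`,
for infinitely many `n`, with `P_{p_c(ℤ³)}`-probability at least `c` the open crossings of
`B(n) → ∂ⁱⁿB(2n)` inside `B(2n)` can all be destroyed by closing at most `k` edges, then with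
probability at least `c` there are at most `k` annulus-spanning box-clusters, infinitely often —
the crux `NonProliferation` with `M = k`. (The hypothesis is the `l = 2` slice of
`PercBudgetLadder.BudgetTightness`, stmt-CriticalPhenomena-5248.) -/
theorem nonProliferation_of_budgetTightness_two :
    (∃ (k : ℕ) (c : ℝ), 0 < c ∧ ∀ N : ℕ, ∃ n : ℕ, N ≤ n ∧ c ≤
      (bondPercolation (zdGraph 3) (criticalProbI 3)).real
        {ω | ∃ S : Finset (Sym2 (Site 3)), S.card ≤ k ∧
          ¬ ∃ x ∈ box 3 n, ∃ y ∈ innerBoundary (zdGraph 3) (box 3 (2 * n)),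
            (ω \ ↑S) ∈ openConnIn (↑(box 3 (2 * n)) : Set (Site 3)) x y}) →
    Summit.CriticalPhenomena.PercolationContinuityZ3.Theses.PercNonProliferation.NonProliferation := by
  rintro ⟨k, c, hc, hfreq⟩
  rw [nonProliferation_iff]
  refine ⟨k, c, hc, Filter.frequently_atTop.2 fun N => ?_⟩
  obtain ⟨n, hNn, hcn⟩ := hfreq N
  exact ⟨n, hNn, hcn.trans (BudgetBridge.real_cut_le_real_compl_repEvent 3 k n _)⟩

end Summit.CriticalPhenomena.PercolationContinuityZ3.Theorems.NonProliferation

end
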